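import Summits.KontsevichZagierPeriods.KontsevichZagierPeriods.Theorems.TerasomaMultiplicationBetaCancellationOfAyoubPiCancellation
import Summits.KontsevichZagierPeriods.KontsevichZagierPeriods.Theorems.LiouvilleUnfoldingAyoubPiCancellationDictionary
import Summits.KontsevichZagierPeriods.KontsevichZagierPeriods.Theorems.AyoubPiLocalKernel.Negative.LoadBearing
import Summits.KontsevichZagierPeriods.KontsevichZagierPeriods.Theorems.MzvKernelInKZ.Negative.ScalingDivision
import Literature.NumberTheory.Transcendental.KZLogCalculusProofs
import Literature.NumberTheory.Transcendental.KZCalculusProofs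
import Literature.NumberTheory.Transcendental.KZKernelConjectureForms
import Literature.NumberTheory.Transcendental.KZRulesAssociator

/-!
# Disproof of `AyoubPiCancellation` (stmt-KontsevichZagierPeriods-0540) — findings of the standing adversary

Work file of the crux disprover (seat of route HyperbolicBloch; the item is shared VERBATIM by routes
AyoubSpecialisation / KatzTower / AttractorUnfolding / SpheresForWalls / LiouvilleUnfolding /
MultivaluedCoV / HurwitzMicroSectors / HyperbolicBloch — the route decls are syntactically identical,
`HyperbolicBloch.AyoubPiCancellation ↔ AyoubSpecialisation.AyoubPiCancellation := Iff.rfl`, checked;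
this file is written against the home-route decl `AyoubSpecialisation.AyoubPiCancellation`). The
crux, in its filed INTERFACE typing:

  `∀ P : (∀ n, IntegralRep n → IntegralRep (n + 2))`, PINNED (domain of `P n r` = unit disc in the
  two leading coordinates × `r.domain` in the trailing `n`; integrand of `P n r` = `r.integrand` of
  the trailing coordinates) `→ ∀ c, lift (of ∘ P) c ∈ KZ.relations → c ∈ KZ.relations`.

VERDICT OF THIS CYCLE: NO KILL, for the strongest reason — the crux is a CONSEQUENCE OF THE SUMMIT
(`ayoubPiCancellation_of_summit`, §0): every counterexample `c` has `eval c = 0`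
(`eval_eq_zero_of_lift_mem`) and `c ∉ relations`, i.e. refutes the formalised Kontsevich–Zagier
conjecture itself (`not_summit_of_counterexample`). In closed form the item is
`KZ.PiCancellation` (`ayoubPiCancellation_iff_piCancellation`), printed OPEN even in its motivic
shadow (Huber–Wüstholz 2022, App. A.4: injectivity `P̃(MM^eff_Nori) → P̃(MM_Nori)`; Ayoub 2015,
Rem. 1.3). The extensive positive/negative anatomy of the closed form lives in
`Cruxes/BetaCancellation/Disproof.lean` (crux 13633 `≡` 0540, `betaCancellation_iff_ayoubPiCancellation`)
and `Theorems/BetaCancellation/Negative/*` — NOT repeated here. This file adds what is specific to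
the INTERFACE TYPING of 0540 (the pinning hypothesis on `P`, the disc, the shape of the conclusion).
All theorems sorry-free unless marked; axioms ⊆ {propext, Classical.choice, Quot.sound}.

Findings (section numbers):

0. Dictionary / why it resists: `ayoubPiCancellation_iff_piCancellation`, `_of_summit`,
   `not_summit_of_not_ayoubPiCancellation`, `eval_eq_zero_of_lift_mem`,
   `not_summit_of_counterexample`; the converse implication of the crux is a theorem
   (`lift_mem_relations_of_mem`, ideal property), so the crux is an `iff` per element
   (`ayoubPiCancellation_iff_forall_iff`); `∀ P` ranges over exactly one object
   (`ayoubPiCancellation_iff_exists`, the pinned family exists and is unique).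
1. LOAD-BEARING HYPOTHESES (crux VERBATIM with one clause deleted, each FALSE):
   `ayoubPiCancellation_false_without_pinning` (any family `P`; witness: the empty family),
   `_false_without_domainClause` (integrand pinned, domain free; witness: domain `∅`),
   `_false_without_integrandClause` (domain pinned, integrand free; witness: integrand `0`).
   Any proof must use BOTH clauses of the pinning.
2. DEGENERATE / LIMIT PARAMETERS of the disc: radius `0` (`z 0 ^ 2 + z 1 ^ 2 ≤ 0`) is FALSE
   (`_false_at_radius_zero`, null padding); NO disc at all (padding by `ℝ²`) makes the pinning
   UNSATISFIABLE (`noDisc_unsatisfiable`, `∫_{ℝ²} 1 = ∞`) hence the mutated crux VACUOUSLY TRUE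
   (`noDisc_vacuous`). So positivity AND finiteness of the padding measure are both used.
3. REFUTED STRENGTHENINGS: conclusion `c = 0` instead of `c ∈ relations` is FALSE
   (`not_lift_mem_imp_eq_zero`; witness `c = [∅]`); "padding by a relation cancels" is FALSE for
   EVERY padding class in `relations` (`noCancellation_of_padding_mem_relations`: the multiplier
   must have non-zero value — the `[π]`-analogue of the refuted zero-integral kernels of
   `BetaCancellation/Negative/LoadBearing.lean`).
4. BOUNDARY (what makes a padding cancel): `cancellation_of_lift_sub_nsmul_mem` — if
   `lift (of ∘ P) c ≡ k • c` modulo relations for some `k ≥ 1` then cancellation for `P` is a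
   THEOREM (torsion-freeness, `MzvKernelInKZ.Negative.mem_relations_of_nsmul_mem`); instance: the
   UNIT SQUARE in place of the unit disc (`squarePinned_lift_sub_mem`, `squareCancellation`: two
   rule-(3) slab moves + one rule-(2) relabelling). Conversely `[π]` is NOT commensurable with `1`
   modulo relations (`piRep_not_commensurable`, irrationality of `π` + soundness), so this door is
   closed for the disc: THE CONTENT OF THE CRUX IS EXACTLY A PADDING WHOSE CLASS IS INCOMMENSURABLE
   WITH 1.
5. PROVABLE CASES in the crux's typing: single non-negative generators
   (`cancellation_of_nonneg`), and (tree, cited) the subgroup of dimension ≤ 1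
   (`DimOnePiLeaves`, p124986) and all FIBRED / WALL / REGION / WEIGHT / CATALYTIC certificates
   (`TerasomaMultiplicationBetaCancellation{Fibred,Wall,Region,Side,Weight}Descent*.lean`).
6. Targets: none handed over (payload `stuck_stubs = []`). Near-misses: none.

LANDED in the tree (importable; namespace `Summit.KontsevichZagierPeriods.AyoubPiCancellationNegative`,
directory `Summits/…/Theorems/AyoubPiCancellation/Negative/`, both ACCEPTED 2026-08-17):
`LoadBearing.lean` (p139811: §0 structure minus the summit-conditional items, §1, §2, §3) and
`Boundary.lean` (p139828: §4, §5). Ideators / planners / leads may `import` them.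

PROVER BRIEFING (one paragraph). Nothing value-level can fail (§0); the only freedom is the
CERTIFICATE: a relation certificate for `[D] × c` may use rule-(2) substitutions mixing the two disc
coordinates with `c`'s. Every certificate class that does NOT mix (fibred), or mixes compatibly with
one cylinder / chord / weight of the disc, DESCENDS (tree theorems above). §4 says the descent cannot
come from the padding class alone (`[π]` incommensurable with `1`), §1–§3 say it cannot come from
typing slack. What remains is the printed open problem.
-/

noncomputable section

-- `Summit.KontsevichZagierPeriods.KontsevichZagierPeriods.…` is the tree's mandated layout (single-conjunct summit).
set_option linter.dupNamespace false

namespace Summit.KontsevichZagierPeriods.KontsevichZagierPeriods.Cruxes.AyoubPiCancellation.Disproof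

open MeasureTheory Set
open Literature.NumberTheory.Transcendental
open Literature.NumberTheory.Transcendental.KZ
open Literature.ModelTheory.ExponentialFields (IsSemialgebraic isSemialgebraic_univ
  isSemialgebraic_empty)
-- the item's decl in its home route; the decls `HyperbolicBloch.AyoubPiCancellation`,
-- `LiouvilleUnfolding.AyoubPiCancellation`, … of the other routes wanting 0540 are syntactically
-- identical (`Iff.rfl`)
open Summit.KontsevichZagierPeriods.KontsevichZagierPeriods.Theses.AyoubSpecialisation
  (AyoubPiCancellation)
open Summit.KontsevichZagierPeriods.KontsevichZagierPeriods.BetaCancellationLine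
  (exists_pinned piRep_mul_sub_lift_mem_relations lift_mem_relations_iff
    pinned_eq_piRep_prod_reindex piIndex_castAdd_zero piIndex_castAdd_one piIndex_natAdd)
open Summit.KontsevichZagierPeriods.LiouvilleUnfolding.AyoubPiLocalKernelNegative
  (eval_lift of_slab_slab_sub_mem pinned_unique)
open Summit.KontsevichZagierPeriods.MzvKernelInKZ.Negative (mem_relations_of_nsmul_mem)

/-! ## §0 Dictionary and why the crux resists -/

/-- The filed item is the closed-term `π`-cancellation `KZ.PiCancellation` (route decls of all
routes wanting 0540 are syntactically identical; `BetaCancellationLine.stub_ayoubBridge`).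
[folklore] -/
theorem ayoubPiCancellation_iff_piCancellation : AyoubPiCancellation ↔ KZ.PiCancellation :=
  Summit.KontsevichZagierPeriods.KontsevichZagierPeriods.BetaCancellationLine.stub_ayoubBridge

/-- **Why it resists**: the summit implies the crux (soundness of the moves, Fubini
`eval ([π] * c) = π · eval c`, `π ≠ 0`). [folklore] -/
theorem ayoubPiCancellation_of_summit (h : _root_.KontsevichZagierPeriods) : AyoubPiCancellation :=
  (Summit.KontsevichZagierPeriods.LiouvilleUnfolding.PiLocalisation.ayoubPiCancellation_of_summit h :
    Summit.KontsevichZagierPeriods.KontsevichZagierPeriods.Theses.LiouvilleUnfolding.AyoubPiCancellation)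

/-- A refutation of the crux refutes the summit. [folklore] -/
theorem not_summit_of_not_ayoubPiCancellation (h : ¬ AyoubPiCancellation) :
    ¬ _root_.KontsevichZagierPeriods :=
  fun hs => h (ayoubPiCancellation_of_summit hs)

/-- If every `[P n r]` is a relation then `lift (of ∘ P)` maps EVERYTHING into relations (used by
all junk witnesses below). [folklore] -/
theorem lift_mem_relations_of_forall {d : ℕ} (P : ∀ n : ℕ, IntegralRep n → IntegralRep (n + d))
    (hP : ∀ (n : ℕ) (r : IntegralRep n), of (P n r) ∈ relations) (c : FormalRep) :
    FreeAbelianGroup.lift (fun s : (Σ n, IntegralRep n) => of (P s.1 s.2)) c ∈ relations := by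
  induction c using FreeAbelianGroup.induction_on with
  | zero => simp [relations.zero_mem]
  | of s =>
    rw [FreeAbelianGroup.lift_apply_of]
    exact hP s.1 s.2
  | neg s ih =>
    rw [map_neg]
    exact relations.neg_mem ih
  | add x y hx hy =>
    rw [map_add]
    exact relations.add_mem hx hy

/-- **Soundness side**: `lift (of ∘ P) c ∈ relations → eval c = 0` for the pinned family, so
every counterexample to the crux lies in `ker eval ∖ relations`. [folklore] -/
theorem eval_eq_zero_of_lift_mem (P : ∀ n : ℕ, IntegralRep n → IntegralRep (n + 2))
    (hP : ∀ (n : ℕ) (r : IntegralRep n),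
      (P n r).domain = {z : Fin (n + 2) → ℝ | z 0 ^ 2 + z 1 ^ 2 ≤ 1 ∧
          (fun i : Fin n => z i.succ.succ) ∈ r.domain} ∧
        (P n r).integrand = fun z => r.integrand (fun i : Fin n => z i.succ.succ))
    {c : FormalRep}
    (h : FreeAbelianGroup.lift (fun s : (Σ n, IntegralRep n) => of (P s.1 s.2)) c ∈ relations) :
    eval c = 0 := by
  have h0 : eval (FreeAbelianGroup.lift (fun s : (Σ n, IntegralRep n) => of (P s.1 s.2)) c) = 0 :=
    relations_le_ker_eval_holds h
  rw [eval_lift P hP] at h0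
  exact (mul_eq_zero.mp h0).resolve_left Real.pi_ne_zero

/-- **Every counterexample to the crux is a counterexample to Conjecture 1** (kernel form):
`lift (of ∘ P) c ∈ relations ∧ c ∉ relations → eval c = 0 ∧ c ∉ relations → ¬ KZKernelConjecture`.
[folklore] -/
theorem not_kzKernelConjecture_of_counterexample
    (h : ∃ P : ∀ n : ℕ, IntegralRep n → IntegralRep (n + 2),
      (∀ (n : ℕ) (r : IntegralRep n),
        (P n r).domain = {z : Fin (n + 2) → ℝ | z 0 ^ 2 + z 1 ^ 2 ≤ 1 ∧
            (fun i : Fin n => z i.succ.succ) ∈ r.domain} ∧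
          (P n r).integrand = fun z => r.integrand (fun i : Fin n => z i.succ.succ)) ∧
      ∃ c : FormalRep,
        FreeAbelianGroup.lift (fun s : (Σ n, IntegralRep n) => of (P s.1 s.2)) c ∈ relations ∧
          c ∉ relations) :
    ¬ KZKernelConjecture := by
  rintro hK
  obtain ⟨P, hP, c, hc, hcn⟩ := h
  exact hcn (hK c (eval_eq_zero_of_lift_mem P hP hc))

/-- The same, against the summit. [folklore] -/
theorem not_summit_of_counterexample
    (h : ∃ P : ∀ n : ℕ, IntegralRep n → IntegralRep (n + 2),
      (∀ (n : ℕ) (r : IntegralRep n),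
        (P n r).domain = {z : Fin (n + 2) → ℝ | z 0 ^ 2 + z 1 ^ 2 ≤ 1 ∧
            (fun i : Fin n => z i.succ.succ) ∈ r.domain} ∧
          (P n r).integrand = fun z => r.integrand (fun i : Fin n => z i.succ.succ)) ∧
      ∃ c : FormalRep,
        FreeAbelianGroup.lift (fun s : (Σ n, IntegralRep n) => of (P s.1 s.2)) c ∈ relations ∧
          c ∉ relations) :
    ¬ _root_.KontsevichZagierPeriods :=
  fun hs => not_kzKernelConjecture_of_counterexample h
    ((kzKernelConjecture_iff_isRational).2 hs)

/-- **The converse implication of the crux is a theorem**: `c ∈ relations → lift (of ∘ P) c ∈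
relations` (relations form an ideal under the Fubini product, `KZ.piRep_mul_mem_relations`, and
`lift (of ∘ P) ≡ [π] * ·`). [folklore] -/
theorem lift_mem_relations_of_mem (P : ∀ n : ℕ, IntegralRep n → IntegralRep (n + 2))
    (hP : ∀ (n : ℕ) (r : IntegralRep n),
      (P n r).domain = {z : Fin (n + 2) → ℝ | z 0 ^ 2 + z 1 ^ 2 ≤ 1 ∧
          (fun i : Fin n => z i.succ.succ) ∈ r.domain} ∧
        (P n r).integrand = fun z => r.integrand (fun i : Fin n => z i.succ.succ))
    {c : FormalRep} (hc : c ∈ relations) :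
    FreeAbelianGroup.lift (fun s : (Σ n, IntegralRep n) => of (P s.1 s.2)) c ∈ relations :=
  (lift_mem_relations_iff P hP c).2 (piRep_mul_mem_relations hc)

/-- The crux per element is an `iff`: `AyoubPiCancellation ↔ ∀ P pinned, ∀ c,
(lift (of ∘ P) c ∈ relations ↔ c ∈ relations)`. [folklore] -/
theorem ayoubPiCancellation_iff_forall_iff :
    AyoubPiCancellation ↔ ∀ P : ∀ n : ℕ, IntegralRep n → IntegralRep (n + 2),
      (∀ (n : ℕ) (r : IntegralRep n),
        (P n r).domain = {z : Fin (n + 2) → ℝ | z 0 ^ 2 + z 1 ^ 2 ≤ 1 ∧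
            (fun i : Fin n => z i.succ.succ) ∈ r.domain} ∧
          (P n r).integrand = fun z => r.integrand (fun i : Fin n => z i.succ.succ)) →
      ∀ c : FormalRep,
        (FreeAbelianGroup.lift (fun s : (Σ n, IntegralRep n) => of (P s.1 s.2)) c ∈ relations ↔
          c ∈ relations) := by
  refine forall₂_congr fun P hP => forall_congr' fun c => ?_
  exact ⟨fun h => ⟨h, lift_mem_relations_of_mem P hP⟩, fun h => h.1⟩

/-- `∀ P pinned` ranges over exactly one object: the crux is equivalent to its `∃ P` form
(`BetaCancellationLine.exists_pinned`, `AyoubPiLocalKernelNegative.pinned_unique`). [folklore] -/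
theorem ayoubPiCancellation_iff_exists :
    AyoubPiCancellation ↔ ∃ P : ∀ n : ℕ, IntegralRep n → IntegralRep (n + 2),
      (∀ (n : ℕ) (r : IntegralRep n),
        (P n r).domain = {z : Fin (n + 2) → ℝ | z 0 ^ 2 + z 1 ^ 2 ≤ 1 ∧
            (fun i : Fin n => z i.succ.succ) ∈ r.domain} ∧
          (P n r).integrand = fun z => r.integrand (fun i : Fin n => z i.succ.succ)) ∧
      ∀ c : FormalRep,
        FreeAbelianGroup.lift (fun s : (Σ n, IntegralRep n) => of (P s.1 s.2)) c ∈ relations →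
          c ∈ relations := by
  constructor
  · intro h
    obtain ⟨P, hP⟩ := exists_pinned
    exact ⟨P, hP, h P hP⟩
  · rintro ⟨P, hP, h⟩ P' hP' c hc
    rw [← pinned_unique hP hP'] at hc
    exact h c hc

/-! ## §1 LOAD-BEARING HYPOTHESES: both clauses of the pinning -/

/-- **Any proof must use the pinning**: the crux VERBATIM with the pinning hypothesis deleted
(any family `P : ∀ n, IntegralRep n → IntegralRep (n + 2)`) is FALSE. Witness: the empty family
`P n r := [∅] ∈ relations`, `c := [π]` (value `π ≠ 0`). (For the sibling crux 0541 the same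
deletion gives back the summit — `AyoubPiLocalKernelNegative.withoutPinning_iff_kzKernelConjecture`;
here it is plainly false.) [folklore] -/
theorem ayoubPiCancellation_false_without_pinning :
    ¬ ∀ (P : ∀ n : ℕ, IntegralRep n → IntegralRep (n + 2)) (c : FormalRep),
      FreeAbelianGroup.lift (fun s : (Σ n, IntegralRep n) => of (P s.1 s.2)) c ∈ relations →
        c ∈ relations := by
  intro h
  have hmem : of piRep ∈ relations :=
    h (fun n _ => IntegralRep.empty (n + 2)) (of piRep)
      (lift_mem_relations_of_forall _ (fun n _ => IntegralRep.of_empty_mem_relations) _)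
  have h0 : eval (of piRep) = 0 := relations_le_ker_eval_holds hmem
  rw [eval_of_piRep] at h0
  exact Real.pi_ne_zero h0

/-- **Any proof must use the DOMAIN clause of the pinning**: the crux with only the integrand
pinned is FALSE. Witness: `P n r :=` the pinned representation restricted to `∅` (same integrand,
null domain, a relation), `c := [π]`. [folklore] -/
theorem ayoubPiCancellation_false_without_domainClause :
    ¬ ∀ P : ∀ n : ℕ, IntegralRep n → IntegralRep (n + 2),
      (∀ (n : ℕ) (r : IntegralRep n),
        (P n r).integrand = fun z => r.integrand (fun i : Fin n => z i.succ.succ)) →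
      ∀ c : FormalRep,
        FreeAbelianGroup.lift (fun s : (Σ n, IntegralRep n) => of (P s.1 s.2)) c ∈ relations →
          c ∈ relations := by
  intro h
  obtain ⟨P₀, hP₀⟩ := exists_pinned
  let P : ∀ n : ℕ, IntegralRep n → IntegralRep (n + 2) := fun n r =>
    (P₀ n r).restrict ∅ isSemialgebraic_empty (empty_subset _)
  have hP : ∀ (n : ℕ) (r : IntegralRep n),
      (P n r).integrand = fun z => r.integrand (fun i : Fin n => z i.succ.succ) :=
    fun n r => (hP₀ n r).2
  have hrel : ∀ (n : ℕ) (r : IntegralRep n), of (P n r) ∈ relations := fun n r =>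
    of_mem_relations_of_volume_eq_zero _ (by simp [P, IntegralRep.restrict])
  have hmem : of piRep ∈ relations :=
    h P hP (of piRep) (lift_mem_relations_of_forall P hrel _)
  have h0 : eval (of piRep) = 0 := relations_le_ker_eval_holds hmem
  rw [eval_of_piRep] at h0
  exact Real.pi_ne_zero h0

/-- **Any proof must use the INTEGRAND clause of the pinning**: the crux with only the domain
pinned is FALSE. Witness: `P n r :=` the zero representation on the pinned domain (a relation),
`c := [π]`. [folklore] -/
theorem ayoubPiCancellation_false_without_integrandClause :
    ¬ ∀ P : ∀ n : ℕ, IntegralRep n → IntegralRep (n + 2),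
      (∀ (n : ℕ) (r : IntegralRep n),
        (P n r).domain = {z : Fin (n + 2) → ℝ | z 0 ^ 2 + z 1 ^ 2 ≤ 1 ∧
            (fun i : Fin n => z i.succ.succ) ∈ r.domain}) →
      ∀ c : FormalRep,
        FreeAbelianGroup.lift (fun s : (Σ n, IntegralRep n) => of (P s.1 s.2)) c ∈ relations →
          c ∈ relations := by
  intro h
  obtain ⟨P₀, hP₀⟩ := exists_pinned
  have hz : ∀ (n : ℕ) (r : IntegralRep n), ∃ z : IntegralRep (n + 2),
      z.domain = (P₀ n r).domain ∧ z.integrand = 0 :=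
    fun n r => exists_zeroRep (P₀ n r).isSemialgebraic_domain
  choose P hPd hPi using hz
  have hP : ∀ (n : ℕ) (r : IntegralRep n),
      (P n r).domain = {z : Fin (n + 2) → ℝ | z 0 ^ 2 + z 1 ^ 2 ≤ 1 ∧
          (fun i : Fin n => z i.succ.succ) ∈ r.domain} :=
    fun n r => (hPd n r).trans (hP₀ n r).1
  have hrel : ∀ (n : ℕ) (r : IntegralRep n), of (P n r) ∈ relations := fun n r =>
    of_mem_relations_of_eqOn_zero _ (by rw [hPi]; exact fun _ _ => rfl)
  have hmem : of piRep ∈ relations :=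
    h P hP (of piRep) (lift_mem_relations_of_forall P hrel _)
  have h0 : eval (of piRep) = 0 := relations_le_ker_eval_holds hmem
  rw [eval_of_piRep] at h0
  exact Real.pi_ne_zero h0

/-! ## §2 DEGENERATE AND LIMIT PARAMETERS of the disc -/

/-- The degenerate disc `{z 0 ^ 2 + z 1 ^ 2 ≤ 0} × σ` is Lebesgue-null (it lies in the coordinate
hyperplane `z 0 = 0`). [folklore] -/
theorem volume_radiusZero_eq_zero {n : ℕ} (σ : Set (Fin n → ℝ)) :
    volume {z : Fin (n + 2) → ℝ | z 0 ^ 2 + z 1 ^ 2 ≤ 0 ∧ (fun i : Fin n => z i.succ.succ) ∈ σ} = 0 := by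
  refine measure_mono_null (t := Set.pi univ (fun i : Fin (n + 2) => if i = 0 then ({0} : Set ℝ) else univ))
    ?_ ?_
  · intro z hz
    simp only [mem_pi, mem_univ, true_implies]
    intro i
    split_ifs with hi
    · subst hi
      have h := hz.1
      have h0 : z 0 ^ 2 = 0 := by nlinarith [sq_nonneg (z 0), sq_nonneg (z 1)]
      simpa using h0
    · exact mem_univ _
  · rw [volume_pi_pi]
    exact Finset.prod_eq_zero (Finset.mem_univ 0) (by simp)

/-- **Radius `0` is FALSE** (the limit `ρ → 0` of the padding disc): the crux with the unit disc
replaced by the degenerate disc `z 0 ^ 2 + z 1 ^ 2 ≤ 0` is false — a null padding sends everything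
into relations. Witness: the pinned family restricted to the degenerate disc, `c := [π]`. The
padding must have POSITIVE measure. [folklore] -/
theorem ayoubPiCancellation_false_at_radius_zero :
    ¬ ∀ P : ∀ n : ℕ, IntegralRep n → IntegralRep (n + 2),
      (∀ (n : ℕ) (r : IntegralRep n),
        (P n r).domain = {z : Fin (n + 2) → ℝ | z 0 ^ 2 + z 1 ^ 2 ≤ 0 ∧
            (fun i : Fin n => z i.succ.succ) ∈ r.domain} ∧
          (P n r).integrand = fun z => r.integrand (fun i : Fin n => z i.succ.succ)) →
      ∀ c : FormalRep,
        FreeAbelianGroup.lift (fun s : (Σ n, IntegralRep n) => of (P s.1 s.2)) c ∈ relations →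
          c ∈ relations := by
  intro h
  obtain ⟨P₀, hP₀⟩ := exists_pinned
  -- the degenerate disc × σ, as a semialgebraic subset of the pinned domain
  have hsa : ∀ (n : ℕ) (r : IntegralRep n), IsSemialgebraic ℚ
      {z : Fin (n + 2) → ℝ | z 0 ^ 2 + z 1 ^ 2 ≤ 0 ∧ (fun i : Fin n => z i.succ.succ) ∈ r.domain} := by
    intro n r
    have h1 : IsSemialgebraic ℚ {z : Fin (n + 2) → ℝ | z 0 ^ 2 + z 1 ^ 2 ≤ 0} := by
      have h := Literature.ModelTheory.ExponentialFields.isSemialgebraic_setOf_eval_le (k := ℚ)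
        (R := ℝ) ((MvPolynomial.X 0) ^ 2 + (MvPolynomial.X 1) ^ 2 : MvPolynomial (Fin (n + 2)) ℚ) 0
      simp only [map_add, map_pow, MvPolynomial.aeval_X, map_zero] at h
      exact h
    have h2 := (P₀ n r).isSemialgebraic_domain
    rw [(hP₀ n r).1] at h2
    have hset : {z : Fin (n + 2) → ℝ | z 0 ^ 2 + z 1 ^ 2 ≤ 0 ∧
        (fun i : Fin n => z i.succ.succ) ∈ r.domain} =
        {z : Fin (n + 2) → ℝ | z 0 ^ 2 + z 1 ^ 2 ≤ 0} ∩
          {z : Fin (n + 2) → ℝ | z 0 ^ 2 + z 1 ^ 2 ≤ 1 ∧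
            (fun i : Fin n => z i.succ.succ) ∈ r.domain} := by
      ext z
      simp only [mem_setOf_eq, mem_inter_iff]
      constructor
      · rintro ⟨hz, hσ⟩
        exact ⟨hz, by nlinarith [sq_nonneg (z 0), sq_nonneg (z 1)], hσ⟩
      · rintro ⟨hz, -, hσ⟩
        exact ⟨hz, hσ⟩
    rw [hset]
    exact h1.inter h2
  have hsub : ∀ (n : ℕ) (r : IntegralRep n),
      {z : Fin (n + 2) → ℝ | z 0 ^ 2 + z 1 ^ 2 ≤ 0 ∧ (fun i : Fin n => z i.succ.succ) ∈ r.domain} ⊆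
        (P₀ n r).domain := by
    intro n r z hz
    rw [(hP₀ n r).1]
    exact ⟨by nlinarith [hz.1, sq_nonneg (z 0), sq_nonneg (z 1)], hz.2⟩
  let P : ∀ n : ℕ, IntegralRep n → IntegralRep (n + 2) := fun n r =>
    (P₀ n r).restrict _ (hsa n r) (hsub n r)
  have hP : ∀ (n : ℕ) (r : IntegralRep n),
      (P n r).domain = {z : Fin (n + 2) → ℝ | z 0 ^ 2 + z 1 ^ 2 ≤ 0 ∧
          (fun i : Fin n => z i.succ.succ) ∈ r.domain} ∧
        (P n r).integrand = fun z => r.integrand (fun i : Fin n => z i.succ.succ) :=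
    fun n r => ⟨rfl, (hP₀ n r).2⟩
  have hrel : ∀ (n : ℕ) (r : IntegralRep n), of (P n r) ∈ relations := fun n r =>
    of_mem_relations_of_volume_eq_zero _ (volume_radiusZero_eq_zero r.domain)
  have hmem : of piRep ∈ relations :=
    h P hP (of piRep) (lift_mem_relations_of_forall P hrel _)
  have h0 : eval (of piRep) = 0 := relations_le_ker_eval_holds hmem
  rw [eval_of_piRep] at h0
  exact Real.pi_ne_zero h0

/-- Lebesgue measure of `ℝ²` (as `Fin 2 → ℝ`-indexed coordinates of `Fin (0 + 2) → ℝ`) is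
infinite. [folklore] -/
theorem volume_univ_fin_two : volume (univ : Set (Fin (0 + 2) → ℝ)) = ⊤ := by
  rw [volume_pi, Measure.pi_univ]
  simp

/-- **No disc at all: the pinning becomes UNSATISFIABLE.** Padding by the whole plane `ℝ²`
(the limit `ρ → ∞`): no family `P` has `(P 0 [pt, 1]).domain = ℝ²` with integrand `1`, because
`1 ∉ L¹(ℝ²)` while `IntegralRep` demands absolute integrability. [folklore] -/
theorem noDisc_unsatisfiable :
    ¬ ∃ P : ∀ n : ℕ, IntegralRep n → IntegralRep (n + 2),
      ∀ (n : ℕ) (r : IntegralRep n),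
        (P n r).domain = {z : Fin (n + 2) → ℝ | (fun i : Fin n => z i.succ.succ) ∈ r.domain} ∧
          (P n r).integrand = fun z => r.integrand (fun i : Fin n => z i.succ.succ) := by
  rintro ⟨P, hP⟩
  have hd : (P 0 IntegralRep.unit).domain = univ := by
    rw [(hP 0 IntegralRep.unit).1]
    ext z
    simp
  have hi : (P 0 IntegralRep.unit).integrand = fun _ => 1 := by
    rw [(hP 0 IntegralRep.unit).2]
    rfl
  have hint := (P 0 IntegralRep.unit).integrableOn
  rw [hd, hi, integrableOn_const_iff] at hint
  rcases hint with h | h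
  · simp at h
  · rw [volume_univ_fin_two] at h
    exact lt_irrefl _ h

/-- Hence the crux with the disc constraint DELETED is VACUOUSLY TRUE (true for the wrong reason):
finiteness of the padding measure is used through the very typing of `IntegralRep`. [folklore] -/
theorem noDisc_vacuous :
    ∀ P : ∀ n : ℕ, IntegralRep n → IntegralRep (n + 2),
      (∀ (n : ℕ) (r : IntegralRep n),
        (P n r).domain = {z : Fin (n + 2) → ℝ | (fun i : Fin n => z i.succ.succ) ∈ r.domain} ∧
          (P n r).integrand = fun z => r.integrand (fun i : Fin n => z i.succ.succ)) →
      ∀ c : FormalRep,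
        FreeAbelianGroup.lift (fun s : (Σ n, IntegralRep n) => of (P s.1 s.2)) c ∈ relations →
          c ∈ relations :=
  fun P hP => absurd ⟨P, hP⟩ noDisc_unsatisfiable

/-! ## §3 REFUTED STRENGTHENINGS -/

/-- A generator of the free abelian group `FormalRep` is not `0`. [folklore] -/
theorem of_ne_zero {n : ℕ} (r : IntegralRep n) : of r ≠ 0 := by
  intro h
  have := congrArg (FreeAbelianGroup.lift (fun _ : (Σ n, IntegralRep n) => (1 : ℤ))) h
  rw [of, FreeAbelianGroup.lift_apply_of, map_zero] at this
  exact one_ne_zero this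

/-- **Strengthening the conclusion to `c = 0` is FALSE**: `lift (of ∘ P)` is injective on the free
group (`PiCancellationForms.piMul_injective`), but modulo relations the most one can ask is
`c ∈ relations`. Witness: `c := [∅] ∈ relations`, `c ≠ 0`. [folklore] -/
theorem not_lift_mem_imp_eq_zero :
    ¬ ∀ P : ∀ n : ℕ, IntegralRep n → IntegralRep (n + 2),
      (∀ (n : ℕ) (r : IntegralRep n),
        (P n r).domain = {z : Fin (n + 2) → ℝ | z 0 ^ 2 + z 1 ^ 2 ≤ 1 ∧
            (fun i : Fin n => z i.succ.succ) ∈ r.domain} ∧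
          (P n r).integrand = fun z => r.integrand (fun i : Fin n => z i.succ.succ)) →
      ∀ c : FormalRep,
        FreeAbelianGroup.lift (fun s : (Σ n, IntegralRep n) => of (P s.1 s.2)) c ∈ relations →
          c = 0 := by
  intro h
  obtain ⟨P, hP⟩ := exists_pinned
  exact of_ne_zero (IntegralRep.empty 0)
    (h P hP _ (lift_mem_relations_of_mem P hP (IntegralRep.of_empty_mem_relations)))

/-- **Padding by a relation never cancels** (the `[π]`-slot must carry a class of non-zero VALUE):
for every family `P` whose members are all relations — e.g. the disc with integrand `0`, any null
padding, any padding `ρ × r` with `[ρ] ∈ relations` — the cancellation statement is FALSE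
(witness `c := [π]`). This is the multiplier-side analogue of the refuted zero-integral kernels of
`BetaCancellationNegative.not_kernelCancellation_of_odd`. [folklore] -/
theorem noCancellation_of_padding_mem_relations {d : ℕ}
    (P : ∀ n : ℕ, IntegralRep n → IntegralRep (n + d))
    (hP : ∀ (n : ℕ) (r : IntegralRep n), of (P n r) ∈ relations) :
    ¬ ∀ c : FormalRep,
      FreeAbelianGroup.lift (fun s : (Σ n, IntegralRep n) => of (P s.1 s.2)) c ∈ relations →
        c ∈ relations := by
  intro h
  have hmem : of piRep ∈ relations := h (of piRep) (lift_mem_relations_of_forall P hP _)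
  have h0 : eval (of piRep) = 0 := relations_le_ker_eval_holds hmem
  rw [eval_of_piRep] at h0
  exact Real.pi_ne_zero h0

/-! ## §4 BOUNDARY: commensurable paddings cancel; `[π]` is incommensurable with `1` -/

/-- **Commensurable paddings cancel.** If a family `P` satisfies `lift (of ∘ P) c − k • c ∈
relations` for all `c`, for one integer `k ≥ 1` (the padding class is `k` times the unit modulo
the moves), then cancellation for `P` is a THEOREM: integer division is a derived rule
(`MzvKernelInKZ.Negative.mem_relations_of_nsmul_mem`). [folklore] -/
theorem cancellation_of_lift_sub_nsmul_mem {d : ℕ} (P : ∀ n : ℕ, IntegralRep n → IntegralRep (n + d))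
    {k : ℕ} (hk : 0 < k)
    (hP : ∀ c : FormalRep,
      FreeAbelianGroup.lift (fun s : (Σ n, IntegralRep n) => of (P s.1 s.2)) c - k • c ∈ relations)
    (c : FormalRep)
    (hc : FreeAbelianGroup.lift (fun s : (Σ n, IntegralRep n) => of (P s.1 s.2)) c ∈ relations) :
    c ∈ relations := by
  refine mem_relations_of_nsmul_mem hk ?_
  have := relations.sub_mem hc (hP c)
  simpa using this

/-- The coordinate relabelling moving the two TRAILING coordinates of `Fin (n + 2)` to the front. -/
private theorem squareIndex_eq (n : ℕ) :
    ∃ e : Fin (n + 2) ≃ Fin (n + 2),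
      (∀ i : Fin n, e (Fin.castSucc (Fin.castSucc i)) = i.succ.succ) ∧
        e (Fin.castSucc (Fin.last n)) = 0 ∧ e (Fin.last (n + 1)) = 1 := by
  refine ⟨finAddFlip.trans (finCongr (Nat.add_comm 2 n)), fun i => ?_, ?_, ?_⟩
  · have : (Fin.castSucc (Fin.castSucc i) : Fin (n + 2)) = Fin.castAdd 2 i := Fin.ext rfl
    rw [this, Equiv.trans_apply, finAddFlip_apply_castAdd, piIndex_natAdd]
  · have : (Fin.castSucc (Fin.last n) : Fin (n + 2)) = Fin.natAdd n (0 : Fin 2) := Fin.ext (by simp)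
    rw [this, Equiv.trans_apply, finAddFlip_apply_natAdd, piIndex_castAdd_zero]
  · have : (Fin.last (n + 1) : Fin (n + 2)) = Fin.natAdd n (1 : Fin 2) := Fin.ext (by simp)
    rw [this, Equiv.trans_apply, finAddFlip_apply_natAdd, piIndex_castAdd_one]

/-- **The unit SQUARE in place of the unit disc: `lift (of ∘ P) c ≡ c`.** For the family pinned to
`[0,1]² × σ` (square in the two leading coordinates, integrand of the trailing ones),
`lift (of ∘ P) c − c ∈ relations`: on a generator, `P r` is the double slab `(r.slab 0).slab 0`
(two rule-(3) moves from `r`, `AyoubPiLocalKernelNegative.of_slab_slab_sub_mem`) relabelled by one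
rule-(2) coordinate permutation (`KZ.of_sub_of_reindex_mem_relations`). [folklore] -/
theorem squarePinned_lift_sub_mem (P : ∀ n : ℕ, IntegralRep n → IntegralRep (n + 2))
    (hP : ∀ (n : ℕ) (r : IntegralRep n),
      (P n r).domain = {z : Fin (n + 2) → ℝ | z 0 ∈ Icc (0:ℝ) 1 ∧ z 1 ∈ Icc (0:ℝ) 1 ∧
          (fun i : Fin n => z i.succ.succ) ∈ r.domain} ∧
        (P n r).integrand = fun z => r.integrand (fun i : Fin n => z i.succ.succ))
    (c : FormalRep) :
    FreeAbelianGroup.lift (fun s : (Σ n, IntegralRep n) => of (P s.1 s.2)) c - c ∈ relations := by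
  -- on generators: `P n r = ((r.slab 0).slab 0).reindex e`
  have hgen : ∀ (n : ℕ) (r : IntegralRep n), of (P n r) - of r ∈ relations := by
    intro n r
    obtain ⟨e, he, he0, he1⟩ := squareIndex_eq n
    have hii : ∀ w : Fin (n + 2) → ℝ,
        Fin.init (Fin.init fun i => w (e i)) = fun i : Fin n => w i.succ.succ := fun w => by
      funext i
      simp only [Fin.init, he]
    have hl0 : ∀ w : Fin (n + 2) → ℝ, (Fin.init fun i => w (e i)) (Fin.last n) = w 0 := fun w => by
      simp only [Fin.init, he0]
    have hPe : P n r = ((r.slab 0).slab 0).reindex e := by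
      refine IntegralRep.ext' ?_ ?_
      · rw [(hP n r).1, IntegralRep.reindex_domain]
        ext w
        simp only [mem_setOf_eq, IntegralRep.domain_slab, IntegralRep.slabDomain, hii, hl0, he1,
          Nat.cast_zero, zero_add, mem_Icc]
        tauto
      · rw [(hP n r).2, IntegralRep.reindex_integrand]
        funext w
        simp only [IntegralRep.integrand_slab, hii]
    rw [hPe]
    have h1 := of_sub_of_reindex_mem_relations ((r.slab 0).slab 0) e
    have h2 := of_slab_slab_sub_mem r
    have e3 : of (((r.slab 0).slab 0).reindex e) - of r =
        -(of ((r.slab 0).slab 0) - of (((r.slab 0).slab 0).reindex e)) +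
          (of ((r.slab 0).slab 0) - of r) := by abel
    rw [e3]
    exact relations.add_mem (relations.neg_mem h1) h2
  induction c using FreeAbelianGroup.induction_on with
  | zero => simp [relations.zero_mem]
  | of s =>
    obtain ⟨n, r⟩ := s
    rw [FreeAbelianGroup.lift_apply_of]
    exact hgen n r
  | neg s ih =>
    have e : FreeAbelianGroup.lift (fun s : (Σ n, IntegralRep n) => of (P s.1 s.2))
          (-FreeAbelianGroup.of s) - -FreeAbelianGroup.of s =
        -(FreeAbelianGroup.lift (fun s : (Σ n, IntegralRep n) => of (P s.1 s.2))
          (FreeAbelianGroup.of s) - FreeAbelianGroup.of s) := by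
      rw [map_neg]; abel
    rw [e]
    exact relations.neg_mem ih
  | add x y hx hy =>
    rw [map_add]
    have e : FreeAbelianGroup.lift (fun s : (Σ n, IntegralRep n) => of (P s.1 s.2)) x +
        FreeAbelianGroup.lift (fun s : (Σ n, IntegralRep n) => of (P s.1 s.2)) y - (x + y) =
        (FreeAbelianGroup.lift (fun s : (Σ n, IntegralRep n) => of (P s.1 s.2)) x - x) +
          (FreeAbelianGroup.lift (fun s : (Σ n, IntegralRep n) => of (P s.1 s.2)) y - y) := by
      abel
    rw [e]
    exact relations.add_mem hx hy

/-- **SQUARE CANCELLATION is a theorem**: the crux with the unit disc `z 0 ^ 2 + z 1 ^ 2 ≤ 1`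
replaced by the unit square `z 0, z 1 ∈ [0,1]` HOLDS (`k = 1` in
`cancellation_of_lift_sub_nsmul_mem`). The content of the crux is therefore exactly that the
padding class `[π]` is not (known to be) commensurable with `1` modulo the moves — and it is
provably NOT commensurable (`piRep_not_commensurable`). [folklore] -/
theorem squareCancellation :
    ∀ P : ∀ n : ℕ, IntegralRep n → IntegralRep (n + 2),
      (∀ (n : ℕ) (r : IntegralRep n),
        (P n r).domain = {z : Fin (n + 2) → ℝ | z 0 ∈ Icc (0:ℝ) 1 ∧ z 1 ∈ Icc (0:ℝ) 1 ∧
            (fun i : Fin n => z i.succ.succ) ∈ r.domain} ∧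
          (P n r).integrand = fun z => r.integrand (fun i : Fin n => z i.succ.succ)) →
      ∀ c : FormalRep,
        FreeAbelianGroup.lift (fun s : (Σ n, IntegralRep n) => of (P s.1 s.2)) c ∈ relations →
          c ∈ relations := by
  intro P hP c hc
  have := relations.sub_mem hc (squarePinned_lift_sub_mem P hP c)
  simpa using this

/-- The square-pinned family exists (non-vacuity of `squareCancellation`). [folklore] -/
theorem exists_squarePinned :
    ∃ P : ∀ n : ℕ, IntegralRep n → IntegralRep (n + 2),
      ∀ (n : ℕ) (r : IntegralRep n),
        (P n r).domain = {z : Fin (n + 2) → ℝ | z 0 ∈ Icc (0:ℝ) 1 ∧ z 1 ∈ Icc (0:ℝ) 1 ∧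
            (fun i : Fin n => z i.succ.succ) ∈ r.domain} ∧
          (P n r).integrand = fun z => r.integrand (fun i : Fin n => z i.succ.succ) := by
  have hE : ∀ n : ℕ, ∃ e : Fin (n + 2) ≃ Fin (n + 2),
      (∀ i : Fin n, e (Fin.castSucc (Fin.castSucc i)) = i.succ.succ) ∧
        e (Fin.castSucc (Fin.last n)) = 0 ∧ e (Fin.last (n + 1)) = 1 := squareIndex_eq
  choose e he he0 he1 using hE
  have hii : ∀ (n : ℕ) (w : Fin (n + 2) → ℝ),
      Fin.init (Fin.init fun i => w (e n i)) = fun i : Fin n => w i.succ.succ := fun n w => by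
    funext i
    simp only [Fin.init, he]
  have hl0 : ∀ (n : ℕ) (w : Fin (n + 2) → ℝ), (Fin.init fun i => w (e n i)) (Fin.last n) = w 0 :=
    fun n w => by simp only [Fin.init, he0]
  refine ⟨fun n r => ((r.slab 0).slab 0).reindex (e n), fun n r => ⟨?_, ?_⟩⟩
  · rw [IntegralRep.reindex_domain]
    ext w
    simp only [mem_setOf_eq, IntegralRep.domain_slab, IntegralRep.slabDomain, hii, hl0, he1,
      Nat.cast_zero, zero_add, mem_Icc]
    tauto
  · rw [IntegralRep.reindex_integrand]
    funext w
    simp only [IntegralRep.integrand_slab, hii]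

/-- **`[π]` is incommensurable with `1` modulo the moves**: `b • [π] − a • [pt, 1] ∈ relations`
forces `a = b = 0` (soundness: `b π = a`, and `π` is irrational). So the trivial door of §4 is
closed for the disc padding; a proof of the crux must cancel a class that no integer multiple
brings to the unit. [folklore] -/
theorem piRep_not_commensurable {a b : ℕ} (h : b • of piRep - a • of IntegralRep.unit ∈ relations) :
    a = 0 ∧ b = 0 := by
  have h0 : eval (b • of piRep - a • of IntegralRep.unit) = 0 := relations_le_ker_eval_holds h
  rw [map_sub, map_nsmul, map_nsmul, eval_of_piRep, eval_of, IntegralRep.value_unit,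
    nsmul_eq_mul, nsmul_eq_mul, mul_one, sub_eq_zero] at h0
  by_cases hb : b = 0
  · subst hb
    simp at h0
    exact ⟨by exact_mod_cast h0.symm, rfl⟩
  · exfalso
    have : Real.pi = (a : ℝ) / b := by
      field_simp
      linarith
    exact irrational_pi.ne_rational a b (by rw [this]; push_cast; ring)

/-! ## §5 PROVABLE CASES in the crux's typing -/

/-- **Non-negative single generators cancel**: if `r.integrand ≥ 0` on `r.domain` then
`lift (of ∘ P) [r] ∈ relations → [r] ∈ relations` (soundness: `π · value r = 0`; a non-negative
integrable function with integral `0` vanishes a.e.; a.e.-zero representations are relations,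
`BetaCancellationNegative.of_mem_relations_of_ae_eq_zero`). The crux has content only for
sign-changing (or multi-term) combinations. [folklore] -/
theorem cancellation_of_nonneg (P : ∀ n : ℕ, IntegralRep n → IntegralRep (n + 2))
    (hP : ∀ (n : ℕ) (r : IntegralRep n),
      (P n r).domain = {z : Fin (n + 2) → ℝ | z 0 ^ 2 + z 1 ^ 2 ≤ 1 ∧
          (fun i : Fin n => z i.succ.succ) ∈ r.domain} ∧
        (P n r).integrand = fun z => r.integrand (fun i : Fin n => z i.succ.succ))
    {n : ℕ} (r : IntegralRep n) (hr : ∀ x ∈ r.domain, 0 ≤ r.integrand x)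
    (h : FreeAbelianGroup.lift (fun s : (Σ n, IntegralRep n) => of (P s.1 s.2)) (of r) ∈ relations) :
    of r ∈ relations := by
  have hval : r.value = 0 := by simpa using eval_eq_zero_of_lift_mem P hP h
  refine Summit.KontsevichZagierPeriods.KontsevichZagierPeriods.BetaCancellationNegative.of_mem_relations_of_ae_eq_zero r ?_
  have hint := r.integrableOn
  have hae : (0 : (Fin n → ℝ) → ℝ) ≤ᵐ[volume.restrict r.domain] r.integrand :=
    (ae_restrict_iff' (IntegralRep.measurableSet_domain_holds r)).2
      (Filter.Eventually.of_forall fun x hx => hr x hx)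
  have := (integral_eq_zero_iff_of_nonneg_ae hae hint).1 hval
  exact this

end Summit.KontsevichZagierPeriods.KontsevichZagierPeriods.Cruxes.AyoubPiCancellation.Disproof

end
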